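/-
Copyright (c) 2026 the pub-hodgecm-mathlib formalisation cell (harness21).  Prover seat hodgecm-mathlib-K2E1-p08 (g2), Track B ∕ K2-LIT
(build stream 29), h413 = `stmt-HodgeConjecture-24833`, line `K2_E1_TraceFormulaBeta`; BY-NAME DEAL #9 of the dealer K2E1-plan (g0)
(RULING #8-RESHAPE 2026-09-03T23:47:35Z ∕ 23:49:05Z): `Theorems/K2E1BlockDiagonalCompact.lean`.
-/
import Summits.HodgeConjecture.HodgeConjecture.Theorems.K2E1ResidualCompactOfFiniteLevel   -- ★ p855818 (this seat): density from test functions; brings ★ p855423 `residualSubspace`, `ResidualSpectrumCompact`, ★ p855393 iff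
import Mathlib.Analysis.InnerProductSpace.Projection.Submodule
import HarnessLib

/-!
# K2·E1 — `K2E1BlockDiagonalCompact`: an operator that is COMPACT ON EACH BLOCK of an orthogonal family of invariant closed subspaces, with block norms tending to `0`,
# is compact on their closed span (generalises ★ p855556 from lines to blocks); residual compactness from «character lines ⊕ `π^n(ξ)`-blocks»

Track B ∕ K2-LIT, crux h413 = `stmt-HodgeConjecture-24833`, route of record `HCCMUnconditional`; cell `hodgecm-mathlib`, squad K2; prover seat
`hodgecm-mathlib-K2E1-p08` (g2), BY-NAME DEAL #9 (dealer K2E1-plan (g0) RULING #8-RESHAPE 2026-09-03T23:47:35Z, confirmed 23:49:05Z); lane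
`--supports stmt-HodgeConjecture-24833 --as helper` (count-neutral).  THEOREMS ONLY (no `def`, no `instance`, no notation, no named-fact hypothesis, no `sorry`).
UN-REFEREED (K2E1-r01 closed 23:47:01Z) — box with the next refuter generation.

§1 ABSTRACT HILBERT LEMMA [ReedSimonI1980 Thm. VI.12; Halmos Problem 171 (blocks)].  `E` a Hilbert space, `(W j)_j` pairwise ORTHOGONAL CLOSED subspaces (Mathlib `OrthogonalFamily`),
`T : E →L E` with `T(W j) ⊆ W j`, each block `W j ∋ w ↦ T w` a COMPACT operator, and the block norms `‖T ∘ ι_{W j}‖ → 0` along the cofinite filter.  THEN `w ↦ T w` is compact on every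
subspace `V ≤ closure (⨆ j, W j)` (`isCompactOperator_apply_coe_of_orthogonal_blocks`).  Proof: for `ε > 0` the set `F = {j : ‖T ∘ ι_{W j}‖ ≥ ε}` is finite; `K_F = Σ_{j ∈ F} T ∘ P_{W j}`
(orthogonal projections) is compact; on the ALGEBRAIC span `x = Σ_i x_i` (`x_i ∈ W i`, finitely many) one has `P_{W j} x = x_j`, so `T x − K_F x = Σ_{i ∉ F} T x_i` with the `T x_i ∈ W i`
pairwise orthogonal, whence `‖T x − K_F x‖² = Σ_{i ∉ F} ‖T x_i‖² ≤ ε² Σ ‖x_i‖² = ε² ‖x‖²` (Pythagoras, Mathlib `OrthogonalFamily.norm_sum`); the bound passes to the closure by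
continuity, and the compact operators are norm-closed (Mathlib `isClosed_setOf_isCompactOperator`).  No Hilbert-sum ∕ `lp` machinery is used.
§2 AUTOMORPHIC WRAPPER in ★ p855423's currency [MoeglinWaldspurger1995 I.2.18, V.3.13; Rogawski1990 §13.9 p. 227, Thm. 13.3.6 (b) p. 200].  For an adelic datum `𝒢`,
automorphic `μ`, radicals `𝔓`, and a family `W j` of pairwise orthogonal CLOSED `R`-INVARIANT subspaces of `L²` (★ `ClosedSubrep`; each is then `R(f)`-invariant, ★
`integratedOperator_apply_mem`): (R-a) `hres : L²_res ≤ closure (⨆ j, W j)` and (R-b) «`R(f)|_{W j}` compact for every `j` and `‖R(f) ∘ ι_{W j}‖ → 0` cofinitely» give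
`L²_res ∋ w ↦ R(f) w` compact (`isCompactOperator_residual_of_blocks`), hence ★ `ResidualSpectrumCompact 𝒢 μ 𝔓` when (R-b) holds for all `f ∈ C_c`
(`residualSpectrumCompact_of_blocks`), and ★ `CmResidualSpectrumCompactR L N μ` when (R-b) holds for TEST FUNCTIONS only (`cmResidualSpectrumCompactR_of_blocks`, all `N`, by ★
p855818's density).  PRINT READING: the character LINES `ℂ·(χ∘det)` are one-dimensional blocks (on them (R-b) = ★ p855705's Riemann–Lebesgue decay `tendsto_charCoeff_cofinite`),
and at `N = 3` the further blocks are the `⊗_v π^n(ξ_v)`-isotypic subspaces (`m = 1`), (R-b) there = admissibility + ARCHIMEDEAN DECAY of `‖π^n(ξ_∞)(f_∞)‖` in the `∞`-type of `ξ`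
[Borel–Garland 1983; Muller1989TraceClass] — both NAMED binders, neither hidden; with the empty block family beyond the lines one recovers ★ p855705's `N = 2` statement.

HONEST LABEL: HC_CM is proved only modulo the 7 printed citations (2 remaining named inputs: hLiu418 = `stmt-HodgeConjecture-24832`, h413 = `stmt-HodgeConjecture-24833`)
until rung 0 closes; this file moves no counter and closes no socket (12R3 reads «(R-a) + (R-b)»).

## References
* [ReedSimonI1980] M. Reed, B. Simon, *Methods of Modern Mathematical Physics I*, Thm. VI.12–VI.13 (compact operators: norm-closed; finite sums).
* [MoeglinWaldspurger1995] C. Mœglin, J.-L. Waldspurger, *Spectral decomposition and Eisenstein series* (1995), I.2.18, V.3.13.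
* [Rogawski1990] J. D. Rogawski, *Automorphic Representations of Unitary Groups in Three Variables*, Ann. of Math. Stud. 123 (1990), §13.5 pp. 204–206, §13.9 p. 227, Thm. 13.3.6 (b) p. 200.
* [Muller1989TraceClass] W. Müller, *The trace class conjecture in the theory of automorphic forms*, Ann. of Math. 130 (1989), Thm. 0.1.
-/

set_option autoImplicit false
-- the mandated namespace repeats `HodgeConjecture.HodgeConjecture`, as in every `Theorems/*.lean` of this sub-problem
set_option linter.dupNamespace false

noncomputable section

open Filter Topology MeasureTheory CompactlySupported Submodule
open scoped InnerProductSpace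
open Literature.NumberTheory.Automorphic ContRepresentation
open Summit.HodgeConjecture.HodgeConjecture.Cruxes.H413.K2E1CuspidalSpectrumUnitary
open Summit.HodgeConjecture.HodgeConjecture.Cruxes.H413.K2E1DiscreteSpectrumCompactOfCuspCompact (isCompactOperator_integratedOperatorRestrict_iff)
open Summit.HodgeConjecture.HodgeConjecture.Cruxes.H413.K2E1ResidualCompactOfFiniteLevel (cmResidualSpectrumCompactR_of_testFunctions)

namespace Summit.HodgeConjecture.HodgeConjecture.Cruxes.H413.K2E1BlockDiagonalCompact

/-! ## §1 The abstract Hilbert lemma: block-diagonal compactness -/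

section Hilbert

variable {𝕜 : Type*} [RCLike 𝕜] {E : Type*} [NormedAddCommGroup E] [InnerProductSpace 𝕜 E] {ι : Type*}
  {W : ι → Submodule 𝕜 E} (hWo : OrthogonalFamily 𝕜 (fun j => ↥(W j)) fun j => (W j).subtypeₗᵢ)
  (T : E →L[𝕜] E) (hT : ∀ j, ∀ w ∈ W j, T w ∈ W j)

include hWo in
/-- **Coordinates on the algebraic span**: if `x = Σ_i x_i` (finitely supported, `x_i ∈ W i`) then the orthogonal projection of `x` onto the (complete) block `W j` is `x_j`.
[cite: ReedSimonI1980, Thm. II.3] -/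
theorem orthogonalProjectionOnto_finsuppSum [∀ j, (W j).HasOrthogonalProjection] (f : ι →₀ E) (hf : ∀ i, f i ∈ W i) (j : ι) :
    ((W j).orthogonalProjectionOnto (f.sum fun _ y => y) : E) = f j := by
  classical
  rw [Finsupp.sum, map_sum, Submodule.coe_sum, Finset.sum_eq_single j]
  · exact congrArg Subtype.val (Submodule.orthogonalProjectionOnto_mem_subspace_eq_self (⟨f j, hf j⟩ : W j))
  · intro i _ hij
    rw [Submodule.orthogonalProjectionOnto_apply_of_mem_orthogonal (hWo.isOrtho hij (hf i)), Submodule.coe_zero]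
  · intro hj
    rw [Finsupp.notMem_support_iff.1 hj, map_zero, Submodule.coe_zero]

include hWo hT in
/-- **The tail estimate on the algebraic span.**  For a finite set `F` of indices and `ε ≥ 0` with `‖T w‖ ≤ ε ‖w‖` on every block `W j`, `j ∉ F`: for `x ∈ ⨆ j, W j` (a FINITE sum
`Σ x_i`), `‖T x − Σ_{j ∈ F} T (P_{W j} x)‖ ≤ ε ‖x‖` — the difference is `Σ_{i ∉ F} T x_i`, a sum of pairwise orthogonal vectors (Pythagoras, Mathlib `OrthogonalFamily.norm_sum`).
[cite: ReedSimonI1980, Thm. VI.12] -/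
theorem norm_sub_sum_le_of_mem_iSup [∀ j, (W j).HasOrthogonalProjection] (F : Finset ι) {ε : ℝ} (hε : 0 ≤ ε)
    (hTε : ∀ j, j ∉ F → ∀ w ∈ W j, ‖T w‖ ≤ ε * ‖w‖) {x : E} (hx : x ∈ ⨆ j, W j) :
    ‖T x - ∑ j ∈ F, T ((W j).orthogonalProjectionOnto x : E)‖ ≤ ε * ‖x‖ := by
  classical
  obtain ⟨f, hf, rfl⟩ := (Submodule.mem_iSup_iff_exists_finsupp W x).1 hx
  simp_rw [orthogonalProjectionOnto_finsuppSum hWo f hf]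
  -- the difference is `Σ_{i ∈ supp f, i ∉ F} T (f i)`
  set G : Finset ι := f.support.filter fun i => i ∉ F with hG
  have hF0 : ∑ j ∈ F.filter (fun j => j ∉ f.support), T (f j) = 0 :=
    Finset.sum_eq_zero fun j hj => by rw [Finsupp.notMem_support_iff.1 (Finset.mem_filter.1 hj).2, map_zero]
  have h1 : ∑ j ∈ F, T (f j) = ∑ j ∈ f.support.filter (fun i => i ∈ F), T (f j) := by
    rw [← Finset.sum_filter_add_sum_filter_not F (fun j => j ∈ f.support), hF0, add_zero, Finset.filter_mem_eq_inter,
      Finset.filter_mem_eq_inter, Finset.inter_comm]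
  have hdiff : T (f.sum fun _ y => y) - ∑ j ∈ F, T (f j) = ∑ i ∈ G, T (f i) := by
    rw [Finsupp.sum, map_sum, h1, hG, ← Finset.sum_filter_add_sum_filter_not f.support (fun i => i ∈ F), add_sub_cancel_left]
  rw [hdiff]
  -- Pythagoras for the orthogonal family `T (f i) ∈ W i`
  have hsq : ‖∑ i ∈ G, T (f i)‖ ^ 2 = ∑ i ∈ G, ‖T (f i)‖ ^ 2 := by
    have h := hWo.norm_sum (fun i => (⟨T (f i), hT i _ (hf i)⟩ : W i)) G
    simpa using h
  have hsqx : ‖f.sum fun _ y => y‖ ^ 2 = ∑ i ∈ f.support, ‖f i‖ ^ 2 := by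
    have h := hWo.norm_sum (fun i => (⟨f i, hf i⟩ : W i)) f.support
    simpa [Finsupp.sum] using h
  have hle : ∑ i ∈ G, ‖T (f i)‖ ^ 2 ≤ ε ^ 2 * ∑ i ∈ f.support, ‖f i‖ ^ 2 := by
    calc ∑ i ∈ G, ‖T (f i)‖ ^ 2 ≤ ∑ i ∈ G, (ε * ‖f i‖) ^ 2 :=
          Finset.sum_le_sum fun i hi => by
            have hiF : i ∉ F := (Finset.mem_filter.1 hi).2
            exact pow_le_pow_left₀ (norm_nonneg _) (hTε i hiF _ (hf i)) 2
      _ = ε ^ 2 * ∑ i ∈ G, ‖f i‖ ^ 2 := by rw [Finset.mul_sum]; exact Finset.sum_congr rfl fun i _ => by ring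
      _ ≤ ε ^ 2 * ∑ i ∈ f.support, ‖f i‖ ^ 2 :=
          mul_le_mul_of_nonneg_left (Finset.sum_le_sum_of_subset_of_nonneg (Finset.filter_subset _ _) fun i _ _ => sq_nonneg _) (sq_nonneg _)
  have h2 : ‖∑ i ∈ G, T (f i)‖ ^ 2 ≤ (ε * ‖f.sum fun _ y => y‖) ^ 2 := by
    rw [hsq, mul_pow, hsqx]
    exact hle
  exact (sq_le_sq₀ (norm_nonneg _) (mul_nonneg hε (norm_nonneg _))).1 h2

include hWo hT in
/-- The tail estimate extends to the CLOSED span by continuity. [cite: ReedSimonI1980, Thm. VI.12] -/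
theorem norm_sub_sum_le_of_mem_closure [∀ j, (W j).HasOrthogonalProjection] (F : Finset ι) {ε : ℝ} (hε : 0 ≤ ε)
    (hTε : ∀ j, j ∉ F → ∀ w ∈ W j, ‖T w‖ ≤ ε * ‖w‖) {x : E} (hx : x ∈ (⨆ j, W j).topologicalClosure) :
    ‖T x - ∑ j ∈ F, T ((W j).orthogonalProjectionOnto x : E)‖ ≤ ε * ‖x‖ := by
  have hclosed : IsClosed {x : E | ‖T x - ∑ j ∈ F, T ((W j).orthogonalProjectionOnto x : E)‖ ≤ ε * ‖x‖} := by
    refine isClosed_le ?_ (continuous_const.mul continuous_norm)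
    refine (T.continuous.sub ?_).norm
    exact continuous_finsetSum F fun j _ => T.continuous.comp (continuous_subtype_val.comp (W j).orthogonalProjectionOnto.continuous)
  have hsub : ((⨆ j, W j : Submodule 𝕜 E) : Set E) ⊆ {x : E | ‖T x - ∑ j ∈ F, T ((W j).orthogonalProjectionOnto x : E)‖ ≤ ε * ‖x‖} :=
    fun x hx => norm_sub_sum_le_of_mem_iSup hWo T hT F hε hTε hx
  have hx' : x ∈ closure ((⨆ j, W j : Submodule 𝕜 E) : Set E) := by
    rw [← Submodule.topologicalClosure_coe]; exact hx
  exact closure_minimal hsub hclosed hx'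

include hWo hT in
/-- **BLOCK-DIAGONAL COMPACTNESS.**  `E` a Hilbert space, `W j` pairwise ORTHOGONAL CLOSED subspaces, `T : E →L E` with `T(W j) ⊆ W j`, each block `W j ∋ w ↦ T w` COMPACT, and the block norms
`‖T ∘ ι_{W j}‖ → 0` along the cofinite filter.  Then `w ↦ T w` is a compact operator on EVERY subspace `V ≤ closure (⨆ j, W j)` (in particular on the closed span itself): `T` is the
norm limit there of the compact finite block sums `Σ_{j ∈ F} T ∘ P_{W j}` (tail estimate `norm_sub_sum_le_of_mem_closure`), and the compact operators are norm-closed.  For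
one-dimensional blocks this is ★ p855556 `isCompactOperator_apply_coe_of_orthogonal_eigenlines`. [cite: ReedSimonI1980, Thm. VI.12–VI.13] -/
theorem isCompactOperator_apply_coe_of_orthogonal_blocks [CompleteSpace E] (hWc : ∀ j, IsClosed (W j : Set E))
    (hTc : ∀ j, IsCompactOperator fun w : W j => T w) (hT0 : Tendsto (fun j => ‖T.comp (W j).subtypeL‖) cofinite (𝓝 0))
    (V : Submodule 𝕜 E) (hV : V ≤ (⨆ j, W j).topologicalClosure) :
    IsCompactOperator fun v : V => T v := by
  classical
  haveI : ∀ j, CompleteSpace (W j) := fun j => (hWc j).completeSpace_coe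
  set U : Submodule 𝕜 E := (⨆ j, W j).topologicalClosure with hU
  -- it suffices to treat the closed span `U`
  suffices hU' : IsCompactOperator fun u : U => T u by
    exact hU'.comp_clm (V.subtypeL.codRestrict U fun v => hV v.2)
  -- `S = T ∘ ι_U` is a norm limit of compact operators
  set S : U →L[𝕜] E := T.comp U.subtypeL with hS
  have hmem : S ∈ closure {K : U →L[𝕜] E | IsCompactOperator K} := by
    refine Metric.mem_closure_iff.2 fun ε hε => ?_
    -- the finite exceptional set `F = {j : ‖T ∘ ι_{W j}‖ ≥ ε/2}`
    have hev : ∀ᶠ j in cofinite, ‖T.comp (W j).subtypeL‖ < ε / 2 := hT0 (Iio_mem_nhds (half_pos hε))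
    obtain ⟨F, hF⟩ : ∃ F : Finset ι, ∀ j, j ∉ F → ‖T.comp (W j).subtypeL‖ < ε / 2 := by
      have hfin := Filter.eventually_cofinite.1 hev
      refine ⟨hfin.toFinset, fun j hj => ?_⟩
      by_contra h
      exact hj (hfin.mem_toFinset.2 h)
    have hTε : ∀ j, j ∉ F → ∀ w ∈ W j, ‖T w‖ ≤ ε / 2 * ‖w‖ := by
      intro j hj w hw
      have h := (T.comp (W j).subtypeL).le_opNorm ⟨w, hw⟩
      exact h.trans (mul_le_mul_of_nonneg_right (hF j hj).le (norm_nonneg _))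
    -- the compact finite block sum `K_F`
    set KF : U →L[𝕜] E := ∑ j ∈ F, (T.comp ((W j).subtypeL.comp (W j).orthogonalProjectionOnto)).comp U.subtypeL with hKF
    have hKFc : IsCompactOperator (KF : U → E) := by
      have key : ∀ G : Finset ι, IsCompactOperator
          ((∑ j ∈ G, (T.comp ((W j).subtypeL.comp (W j).orthogonalProjectionOnto)).comp U.subtypeL : U →L[𝕜] E) : U → E) := by
        intro G
        induction G using Finset.induction_on with
        | empty => rw [Finset.sum_empty]; exact isCompactOperator_zero
        | insert j G hj ih =>
          rw [Finset.sum_insert hj]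
          exact (IsCompactOperator.add ((hTc j).comp_clm ((W j).orthogonalProjectionOnto.comp U.subtypeL)) ih :)
      exact key F
    refine ⟨KF, hKFc, ?_⟩
    -- `‖S − K_F‖ ≤ ε/2 < ε`
    have hbd : ‖S - KF‖ ≤ ε / 2 := by
      refine ContinuousLinearMap.opNorm_le_bound _ (half_pos hε).le fun u => ?_
      have h := norm_sub_sum_le_of_mem_closure hWo T hT F (half_pos hε).le hTε u.2
      have hKu : ∀ G : Finset ι, (∑ j ∈ G, (T.comp ((W j).subtypeL.comp (W j).orthogonalProjectionOnto)).comp U.subtypeL : U →L[𝕜] E) u =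
          ∑ j ∈ G, T ((W j).orthogonalProjectionOnto (u : E) : E) := by
        intro G
        induction G using Finset.induction_on with
        | empty => rw [Finset.sum_empty, Finset.sum_empty]; rfl
        | insert j G hj ih => rw [Finset.sum_insert hj, Finset.sum_insert hj, ← ih]; rfl
      have hsub : (S - KF) u = T (u : E) - ∑ j ∈ F, T ((W j).orthogonalProjectionOnto (u : E) : E) := by
        rw [← hKu F]; rfl
      rw [hsub]
      simpa using h
    rw [dist_eq_norm]
    exact hbd.trans_lt (half_lt_self hε)
  rw [isClosed_setOf_isCompactOperator.closure_eq] at hmem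
  exact hmem

end Hilbert

/-! ## §2 Residual compactness from an orthogonal family of invariant blocks containing `L²_res` in its closed span -/

section Automorphic

universe u

variable {K : Type} [Field K] [NumberField K] (𝒢 : AdelicGroupData.{u} K) (μ : Measure 𝒢.automorphicQuotient)
  [𝒢.IsAutomorphicMeasure μ] (𝔓 : 𝒢.ParabolicUnipotentData)

/-- **`R(f)` IS COMPACT ON `L²_res` FROM BLOCKS, one test function at a time.**  `W j` pairwise orthogonal CLOSED `R`-INVARIANT subspaces of `L²` (★ `ClosedSubrep`) with (R-a)
`L²_res ≤ closure (⨆ j, W j)`; for the given Haar `η` and `f ∈ C_c`: (R-b) every block `W j ∋ w ↦ R(f) w` is compact and `‖R(f) ∘ ι_{W j}‖ → 0` cofinitely.  Then `L²_res ∋ w ↦ R(f) w` is compact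
(§1; `R(f)` preserves each `W j`, ★ `integratedOperator_apply_mem`). [cite: ReedSimonI1980, Thm. VI.12] [cite: MoeglinWaldspurger1995, I.2.18 and V.3.13] -/
theorem isCompactOperator_residual_of_blocks {ι : Type*} (W : ι → ClosedSubrep (𝒢.rightRegular μ))
    (hWo : OrthogonalFamily ℂ (fun j => ↥((W j).toSubmodule)) fun j => (W j).toSubmodule.subtypeₗᵢ)
    (hres : (residualSubspace 𝒢 μ 𝔓).toSubmodule ≤ (⨆ j, (W j).toSubmodule).topologicalClosure)
    [MeasurableSpace 𝒢.Adelic] [BorelSpace 𝒢.Adelic] (η : Measure 𝒢.Adelic) [η.IsHaarMeasure] (f : C_c(𝒢.Adelic, ℂ))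
    (hcpt : ∀ j, IsCompactOperator fun w : (W j).toSubmodule =>
      (𝒢.rightRegular μ).integratedOperator (𝒢.isUnitary_rightRegular μ) (𝒢.isStronglyContinuous_rightRegular_holds μ) η f (w : 𝒢.L2 μ))
    (hdecay : Tendsto (fun j => ‖((𝒢.rightRegular μ).integratedOperator (𝒢.isUnitary_rightRegular μ) (𝒢.isStronglyContinuous_rightRegular_holds μ) η f).comp
      (W j).toSubmodule.subtypeL‖) cofinite (𝓝 0)) :
    IsCompactOperator fun w : (residualSubspace 𝒢 μ 𝔓).toSubmodule =>
      (𝒢.rightRegular μ).integratedOperator (𝒢.isUnitary_rightRegular μ) (𝒢.isStronglyContinuous_rightRegular_holds μ) η f (w : 𝒢.L2 μ) :=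
  isCompactOperator_apply_coe_of_orthogonal_blocks (W := fun j => (W j).toSubmodule) hWo _
    (fun j _ hw => integratedOperator_apply_mem _ _ η f (W j) hw) (fun j => (W j).isClosed) hcpt hdecay _ hres

/-- **★ `ResidualSpectrumCompact 𝒢 μ 𝔓` FROM (R-a) + (R-b) for all `f ∈ C_c`.** [cite: MoeglinWaldspurger1995, I.2.18 and V.3.13] [cite: ReedSimonI1980, Thm. VI.12] -/
theorem residualSpectrumCompact_of_blocks {ι : Type*} (W : ι → ClosedSubrep (𝒢.rightRegular μ))
    (hWo : OrthogonalFamily ℂ (fun j => ↥((W j).toSubmodule)) fun j => (W j).toSubmodule.subtypeₗᵢ)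
    (hres : (residualSubspace 𝒢 μ 𝔓).toSubmodule ≤ (⨆ j, (W j).toSubmodule).topologicalClosure)
    (hRb : ∀ [MeasurableSpace 𝒢.Adelic] [BorelSpace 𝒢.Adelic] (η : Measure 𝒢.Adelic) [η.IsHaarMeasure] (f : C_c(𝒢.Adelic, ℂ)),
      (∀ j, IsCompactOperator fun w : (W j).toSubmodule =>
        (𝒢.rightRegular μ).integratedOperator (𝒢.isUnitary_rightRegular μ) (𝒢.isStronglyContinuous_rightRegular_holds μ) η f (w : 𝒢.L2 μ)) ∧
      Tendsto (fun j => ‖((𝒢.rightRegular μ).integratedOperator (𝒢.isUnitary_rightRegular μ) (𝒢.isStronglyContinuous_rightRegular_holds μ) η f).comp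
        (W j).toSubmodule.subtypeL‖) cofinite (𝓝 0)) :
    ResidualSpectrumCompact 𝒢 μ 𝔓 := by
  intro _ _ η _ f
  obtain ⟨hcpt, hdecay⟩ := hRb η f
  exact isCompactOperator_residual_of_blocks 𝒢 μ 𝔓 W hWo hres η f hcpt hdecay

end Automorphic

/-! ## §3 `U(Φ_N)`: (R-a) + (R-b) for TEST FUNCTIONS ⟹ `CmResidualSpectrumCompactR` (all `N`; density ★ p855818) -/

section Unitary

open NumberField Literature.NumberTheory.Automorphic.UnitaryGroup

variable (L : Type) [Field L] [NumberField L] [IsCMField L] (N : ℕ)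
  (μ : Measure (UnitaryGroup.cmDatum L N (Matrix.of fun i j : Fin N => if i.val + j.val + 1 = N then (1 : L) else 0)).automorphicQuotient)
  [(UnitaryGroup.cmDatum L N (Matrix.of fun i j : Fin N => if i.val + j.val + 1 = N then (1 : L) else 0)).IsAutomorphicMeasure μ]

/-- **★ `CmResidualSpectrumCompactR L N μ` (sockets `sig_K2E1ResidualCompactU2` ∕ `…U3R`) FROM CHARACTER LINES ⊕ BLOCKS, TESTED ON TEST FUNCTIONS ONLY.**  `W j` pairwise orthogonal
closed `R`-invariant subspaces of `L²(U(Φ_N)(L⁺)\U(Φ_N)(𝔸))` — print: the lines `ℂ·(χ∘det)` and, at `N = 3`, the `⊗_v π^n(ξ_v)`-blocks — with (R-a) `cmResidualSubspaceR L N μ ≤ closure (⨆ j, W j)`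
(Langlands' description of `L²_res` in rank one) and (R-b) for every Haar `η` and every TEST FUNCTION `φ` (★ `UnitaryGroup.IsTestFunction L N Φ_N`): each block operator
`W j ∋ w ↦ R(φ) w` is compact and `‖R(φ) ∘ ι_{W j}‖ → 0` cofinitely (lines: Riemann–Lebesgue ★ p855705; `π^n`-blocks: admissibility + archimedean decay [Muller1989TraceClass]).
THEN `CmResidualSpectrumCompactR L N μ` — §2 for test functions, then all of `C_c` by ★ p855818 `cmResidualSpectrumCompactR_of_testFunctions`.
[cite: Rogawski1990, §13.9 p. 227 and Thm. 13.3.6 (b) p. 200] [cite: MoeglinWaldspurger1995, I.2.18 and V.3.13] [cite: Muller1989TraceClass, Thm. 0.1] -/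
theorem cmResidualSpectrumCompactR_of_blocks {ι : Type*}
    (W : ι → ClosedSubrep ((UnitaryGroup.cmDatum L N (Matrix.of fun i j : Fin N => if i.val + j.val + 1 = N then (1 : L) else 0)).rightRegular μ))
    (hWo : OrthogonalFamily ℂ (fun j => ↥((W j).toSubmodule)) fun j => (W j).toSubmodule.subtypeₗᵢ)
    (hres : (cmResidualSubspaceR L N μ).toSubmodule ≤ (⨆ j, (W j).toSubmodule).topologicalClosure)
    (hRb : ∀ [MeasurableSpace (UnitaryGroup.cmDatum L N (Matrix.of fun i j : Fin N => if i.val + j.val + 1 = N then (1 : L) else 0)).Adelic]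
      [BorelSpace (UnitaryGroup.cmDatum L N (Matrix.of fun i j : Fin N => if i.val + j.val + 1 = N then (1 : L) else 0)).Adelic]
      (η : Measure (UnitaryGroup.cmDatum L N (Matrix.of fun i j : Fin N => if i.val + j.val + 1 = N then (1 : L) else 0)).Adelic) [η.IsHaarMeasure]
      (φ : C_c((UnitaryGroup.cmDatum L N (Matrix.of fun i j : Fin N => if i.val + j.val + 1 = N then (1 : L) else 0)).Adelic, ℂ)),
      UnitaryGroup.IsTestFunction L N (Matrix.of fun i j : Fin N => if i.val + j.val + 1 = N then (1 : L) else 0) φ →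
      (∀ j, IsCompactOperator fun w : (W j).toSubmodule =>
        ((UnitaryGroup.cmDatum L N (Matrix.of fun i j : Fin N => if i.val + j.val + 1 = N then (1 : L) else 0)).rightRegular μ).integratedOperator
          ((UnitaryGroup.cmDatum L N (Matrix.of fun i j : Fin N => if i.val + j.val + 1 = N then (1 : L) else 0)).isUnitary_rightRegular μ)
          ((UnitaryGroup.cmDatum L N (Matrix.of fun i j : Fin N => if i.val + j.val + 1 = N then (1 : L) else 0)).isStronglyContinuous_rightRegular_holds μ) η φ
          (w : (UnitaryGroup.cmDatum L N (Matrix.of fun i j : Fin N => if i.val + j.val + 1 = N then (1 : L) else 0)).L2 μ)) ∧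
      Tendsto (fun j => ‖(((UnitaryGroup.cmDatum L N (Matrix.of fun i j : Fin N => if i.val + j.val + 1 = N then (1 : L) else 0)).rightRegular μ).integratedOperator
          ((UnitaryGroup.cmDatum L N (Matrix.of fun i j : Fin N => if i.val + j.val + 1 = N then (1 : L) else 0)).isUnitary_rightRegular μ)
          ((UnitaryGroup.cmDatum L N (Matrix.of fun i j : Fin N => if i.val + j.val + 1 = N then (1 : L) else 0)).isStronglyContinuous_rightRegular_holds μ) η φ).comp
        (W j).toSubmodule.subtypeL‖) cofinite (𝓝 0)) :
    CmResidualSpectrumCompactR L N μ := by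
  refine cmResidualSpectrumCompactR_of_testFunctions L N μ fun η _ φ hφ => ?_
  obtain ⟨hcpt, hdecay⟩ := hRb η φ hφ
  exact isCompactOperator_residual_of_blocks _ μ (cmParabolicDataR L N) W hWo hres η φ hcpt hdecay

end Unitary

end Summit.HodgeConjecture.HodgeConjecture.Cruxes.H413.K2E1BlockDiagonalCompact

end
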